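import Mathlib.Topology.Maps.Proper.Basic
import Mathlib.Topology.Algebra.Group.Pointwise
import Mathlib.Topology.Algebra.Group.OpenMapping
import HarnessLib

/-!
# Surjective homomorphisms with compact kernel are proper maps

Topic `Topology/Algebra`; namespace `Literature.Topology.Algebra` (sub-namespace `MonoidHom` after
the object). Two topological inferences used to show that a continuous homomorphism of idele class
groups `ι : C_{L₀} → C_L` is PROPER ("norm-one classes are compact and `|·|_L = |·|²_{L₀}`"):

1. `MonoidHom.isProperMap_of_isOpenMap_of_isCompact_ker`: an open continuous surjective
   homomorphism of topological groups with compact kernel is a proper map (the saturation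
   `N ⁻¹' (N '' F) = F · ker N` of a closed set is closed; fibres are cosets of the kernel); hence
   `MonoidHom.isProperMap_of_isCompact_ker`: a continuous surjective homomorphism from a σ-compact
   Hausdorff group onto a Hausdorff Baire group (e.g. `ℝ_{>0}`) with compact kernel is proper
   (Mathlib's open mapping theorem `MonoidHom.isOpenMap_of_sigmaCompact`);
2. `isProperMap_of_norms`: if `NC ∘ ι = φ ∘ NA` with `NA` such a "norm" on `A`, `NC` continuous on a
   Hausdorff `C` and `φ` a homeomorphism, then `ι : A → C` is proper (Mathlib's
   `isProperMap_of_comp_of_t2`: a map through which a proper map factors is proper).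

Standard point-set topology (N. Bourbaki, *General Topology*, Ch. I §10 and Ch. III §4
[folklore]); everything is proved (Mathlib only).

## Provenance

Reproduced for the tree under the LEAN-IN-TREE rule (2026-08-18) from the pub-hodgecm cell's
package file `HodgeCM/PerL34/ProperCriterion.lean` (DAG-node prover #10 lineage, seat pv10, gate run
22; 130 lines), verbatim up to the namespace and the docstrings, except that its
`isProperMap_of_comp_factor` (which assumed `C` compactly coherent) is replaced by Mathlib's
stronger `isProperMap_of_comp_of_t2`, so `isProperMap_of_norms` drops the `CompactlyCoherentSpace C`
hypothesis.
-/

set_option autoImplicit false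

open Set _root_.Topology Pointwise

namespace Literature.Topology.Algebra

/-! ## Surjective homomorphisms with compact kernel -/

namespace MonoidHom

variable {A M : Type*} [Group A] [TopologicalSpace A] [IsTopologicalGroup A]
  [Group M] [TopologicalSpace M]

/-- An OPEN continuous surjective homomorphism of topological groups with compact kernel is a
proper map. [folklore] -/
theorem isProperMap_of_isOpenMap_of_isCompact_ker (N : A →* M) (hc : Continuous N)
    (ho : IsOpenMap N) (hs : Function.Surjective N) (hK : IsCompact (N.ker : Set A)) :
    IsProperMap N := by
  rw [isProperMap_iff_isClosedMap_and_compact_fibers]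
  refine ⟨hc, ?_, ?_⟩
  · -- closed map: `N ⁻¹' (N '' F) = F * ker N` is closed, and `N` is a quotient map
    intro F hF
    have hq : IsQuotientMap N := ho.isQuotientMap hc hs
    rw [hq.isClosed_preimage.symm]
    have hFK : (N : A → M) ⁻¹' (N '' F) = F * (N.ker : Set A) := by
      ext a
      constructor
      · rintro ⟨b, hb, hba⟩
        refine Set.mem_mul.mpr ⟨b, hb, b⁻¹ * a, ?_, mul_inv_cancel_left b a⟩
        show b⁻¹ * a ∈ N.ker
        rw [_root_.MonoidHom.mem_ker, map_mul, map_inv, hba, inv_mul_cancel]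
      · intro ha
        obtain ⟨b, hb, k, hk, rfl⟩ := Set.mem_mul.mp ha
        refine ⟨b, hb, ?_⟩
        rw [map_mul, show N k = 1 from hk, mul_one]
    rw [hFK]
    exact hF.mul_right_of_isCompact hK
  · -- fibres are cosets of the kernel
    intro m
    obtain ⟨a, rfl⟩ := hs m
    have hfib : (N : A → M) ⁻¹' {N a} = a • (N.ker : Set A) := by
      ext x
      rw [Set.mem_preimage, Set.mem_singleton_iff, Set.mem_smul_set]
      constructor
      · intro hx
        refine ⟨a⁻¹ * x, ?_, by simp⟩
        show a⁻¹ * x ∈ N.ker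
        rw [_root_.MonoidHom.mem_ker, map_mul, map_inv, hx, inv_mul_cancel]
      · rintro ⟨k, hk, rfl⟩
        rw [smul_eq_mul, map_mul, show N k = 1 from hk, mul_one]
    rw [hfib]
    exact hK.smul a

/-- **A continuous surjective homomorphism from a σ-compact Hausdorff group onto a Hausdorff Baire
group with compact kernel is a proper map** (open mapping theorem + the previous lemma); e.g. the
idelic norm `C_K → ℝ_{>0}` once `C_K¹` is compact. [folklore] -/
theorem isProperMap_of_isCompact_ker [T2Space A] [SigmaCompactSpace A]
    [T2Space M] [BaireSpace M] [IsTopologicalGroup M]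
    (N : A →* M) (hc : Continuous N) (hs : Function.Surjective N)
    (hK : IsCompact (N.ker : Set A)) : IsProperMap N :=
  isProperMap_of_isOpenMap_of_isCompact_ker N hc (N.isOpenMap_of_sigmaCompact hs hc) hs hK

end MonoidHom

/-! ## The two steps combined -/

/-- **Properness from compatible norms.** `ι : A → C` continuous, `NA : A →* P` a continuous
surjective homomorphism with compact kernel on a σ-compact Hausdorff group `A` onto a Hausdorff
Baire group `P`, `NC : C → P` continuous on a Hausdorff space `C` with `NC ∘ ι = φ ∘ NA` for a
homeomorphism `φ` of `P` (e.g. squaring on `ℝ_{>0}`): then `ι` is a proper map. [folklore] -/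
theorem isProperMap_of_norms {A C P : Type*} [Group A] [TopologicalSpace A] [IsTopologicalGroup A]
    [T2Space A] [SigmaCompactSpace A] [TopologicalSpace C] [T2Space C]
    [Group P] [TopologicalSpace P] [T2Space P] [BaireSpace P] [IsTopologicalGroup P]
    {ι : A → C} (hι : Continuous ι) (NA : A →* P) (hNA : Continuous NA)
    (hNAs : Function.Surjective NA) (hNA1 : IsCompact (NA.ker : Set A))
    {NC : C → P} (hNC : Continuous NC) (φ : P ≃ₜ P) (h : ∀ a, NC (ι a) = φ (NA a)) :
    IsProperMap ι := by
  have hp : IsProperMap NA := MonoidHom.isProperMap_of_isCompact_ker NA hNA hNAs hNA1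
  have hfac : (fun c => φ.symm (NC c)) ∘ ι = NA := by
    funext a
    simp [h a]
  exact isProperMap_of_comp_of_t2 hι (φ.symm.continuous.comp hNC) (hfac ▸ hp)

end Literature.Topology.Algebra
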